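/-
Origin: expansion seat `planner-pub-hodgecm-pv07-g5-0`, handover #5 2026-08-18T13:07:49Z (md5 4de99c0cb112e5cb65f8321bc132055e; NEW additive leaf; ONE import rewrite Pv07g5.GenuineSchrodingerSubEmbed -> HodgeCM.PerL34.GenuineSchrodingerSubEmbed (my #4); land AFTER my #4; pv13-g5 #6 GenuineSchrodingerSchwartzDense imports it) (`HOME/pub-hodgecm-pv07-g5/lean/Pv07g5/GenuineSchrodingerSchwartz.lean`, md5 4de99c0c, 196 lines);
landed by the gen-8 packager in gate run 30 as `HodgeCM/PerL34/GenuineSchrodingerSchwartz.lean` (import ^import Pv07g5\.GenuineSchrodingerSubEmbed[ \t]*$→import HodgeCM.PerL34.GenuineSchrodingerSubEmbed ×1).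
-/
/-
Copyright: HodgeCM publication cell (pub-hodgecm), DAG node N31 (seam S3, PerL v5 Lemma 4.2(b)) — the Schwartz–Bruhat
subspace of the genuine split Schrödinger model `L²(X)` is stable and contains the model vector and its cyclic
subspace; the S3 END along an equivariant isometric embedding of the Schwartz–Bruhat space.
Prover seat pub-hodgecm-pv07-g5 (DAG-node prover #07, generation 5), file #5 (HANDOVER #5).  Released under the
package licence.

Imports this seat's file #4 (`GenuineSchrodingerSubEmbed`; in the tree `HodgeCM.PerL34.GenuineSchrodingerSubEmbed`)
only.  Complete proofs, no new axioms, nothing cited, no hypothesis posited.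
-/
import Summits.HodgeConjecture.HodgeCM.PerL34.GenuineSchrodingerSubEmbed

/-!
# The Schwartz–Bruhat space of the split model and the S3 END along an embedding of it

`X = Πʳ_{v split} ((L⁺_v)³, 𝒪_v³)` (pv13-g4 `SchrodingerModel.Space`) is a totally disconnected locally compact
group; its Schwartz–Bruhat functions are the locally constant compactly supported ones, i.e. the finite linear
combinations of indicators of compact open subsets.  Inside `L²(X)` (pv13-g4 `μ`):

* `schwartzBruhat L : Submodule ℂ (Lp ℂ 2 (μ L))` := the span of the indicators `indCO A` of compact open `A ⊆ X`;
* `rep_indCO`: the twisted dilation representation maps `1_A` to `weight(k) • 1_{k⁻¹A}` (tree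
  `dilationRep_indicatorConstLp`), so **`schwartzBruhat_stable`**: the Schwartz–Bruhat space is `rep L ν`-stable for
  every twist `ν`;
* `phiE_mem_schwartzBruhat`: the model vectors `φ_e = 1_{e + ∏ 𝒪_v³}` (pv07-g4) lie in it (`isCompact_boxE`), hence
  **`cyclicSpan_le_schwartzBruhat`**: so does the cyclic subspace of `φ_e` (file #3 `Transfer.cyclicSpan`);
* **`exists_compactDomain_thetaLift_ne_zero_genuine_schwartzEmbed`**: file #4's `…_genuine_subEmbed` with
  `V := schwartzBruhat L` — the S3 END for a doubling datum `D` on ANY space `Sp` fed through an isometric embedding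
  `E : schwartzBruhat L →ₗᵢ[ℂ] Sp` equivariant for the (restricted) twisted dilation representation, conclusion for
  `E ⟨φ_e, _⟩`.  This is the shape in which a genuine adelic theta datum on Schwartz–Bruhat functions of `V₃ ⊗ W(𝔸)`
  can meet the torus side of Lemma 4.2(b): by an equivariant isometric copy of `𝒮(X)`, no `L²`-completeness asked.

ABSOLUTE RULE respected: nothing cited; all hypotheses are data, hypotheses of pv09-g5's END passed through unchanged,
or the equivariance equation `hE`.
-/

set_option linter.unusedSectionVars false

noncomputable section

open MeasureTheory MeasureTheory.Measure Set Metric Function Complex ComplexConjugate Topology Filter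
open scoped RestrictedProduct InnerProductSpace NNReal ENNReal TensorProduct Pointwise

namespace HodgeCM.PerL34.PureTensor

open HodgeCM.PerL34.SplitShells HodgeCM.PerL34.AdelicFactorisation HodgeCM.PerL34.RestrictedMeasure
open HodgeCM.PerL34.NoSmallSubgroups HodgeCM.PerL34.EulerFactorisation HodgeCM.PerL34.DiscreteFD
open HodgeCM.PerL34.LocalFactors HodgeCM.PerL34.LocalFactors.DilationModel
open HodgeCM.PerL34.LocalModulus HodgeCM.PerL34.SplitPlaceDilation
open HodgeCM.PerL34.RallisIP HodgeCM.PerL34.Doubling HodgeCM.PerL34.N31d NumberField IsDedekindDomain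
open HodgeCM.PerL34.IdelePlaces HodgeCM.PerL34.RestrictedRegroup HodgeCM.PerL34.RestrictedCutout
open HodgeCM.PerL34.IdelicTorusModel HodgeCM.PerL34.IdelicTorusModel.Genuine

attribute [local instance] LocalFactors.DilationModel.Adic.nontriviallyNormedField
  LocalFactors.DilationModel.Adic.properSpace

namespace SchrodingerModel

namespace Coeff

section Schwartz

variable {L : Type} [Field L] [NumberField L] [IsCMField L]
  [∀ v : HeightOneSpectrum (𝓞 (maximalRealSubfield L)), MeasurableSpace (v.adicCompletion (maximalRealSubfield L))]
  [∀ v : HeightOneSpectrum (𝓞 (maximalRealSubfield L)), BorelSpace (v.adicCompletion (maximalRealSubfield L))]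
  [DecidableEq (Place (maximalRealSubfield L))]

/-! ## §1  Indicators of compact open sets and the Schwartz–Bruhat subspace -/

variable (L) in
/-- the indicator of a compact open subset of `X`, in `L²(X)` (finite measure: Haar measure of a compact set). -/
def indCO (A : Set (Space L)) (hA : IsCompact A) (hA' : IsOpen A) : Lp ℂ 2 (μ L) :=
  indicatorConstLp 2 hA'.measurableSet hA.measure_lt_top.ne (1 : ℂ)

variable (L) in
/-- **the Schwartz–Bruhat subspace** `𝒮(X) ⊂ L²(X)`: finite linear combinations of indicators of compact open sets
(= the locally constant compactly supported functions on the totally disconnected locally compact group `X`). -/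
def schwartzBruhat : Submodule ℂ (Lp ℂ 2 (μ L)) :=
  Submodule.span ℂ (Set.range fun A : {A : Set (Space L) // IsCompact A ∧ IsOpen A} => indCO L A.1 A.2.1 A.2.2)

/-- (Ported verbatim from the HodgeCMPerL package; no docstring in the source.) -/
theorem indCO_mem_schwartzBruhat (A : Set (Space L)) (hA : IsCompact A) (hA' : IsOpen A) :
    indCO L A hA hA' ∈ schwartzBruhat L :=
  Submodule.subset_span ⟨⟨A, hA, hA'⟩, rfl⟩

/-- the twisted dilation representation on an indicator of a compact open set: `ω_ν(k) 1_A = weight_ν(k) • 1_{k⁻¹A}`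
(tree `dilationRep_indicatorConstLp`; `k⁻¹A = (k • ·)⁻¹' A` is again compact open). -/
theorem rep_indCO (ν : Model L →* Circle) (k : Model L) (A : Set (Space L)) (hA : IsCompact A) (hA' : IsOpen A) :
    rep L ν k (indCO L A hA hA')
      = weight (Space L) ν k • indCO L ((fun x : Space L => k • x) ⁻¹' A)
          ((Homeomorph.smul k).isCompact_preimage.mpr hA) (hA'.preimage (continuous_const_smul k)) :=
  dilationRep_indicatorConstLp (μ L) ν k hA'.measurableSet hA.measure_lt_top.ne

/-- **the Schwartz–Bruhat subspace is stable** under every twisted dilation representation `rep L ν`. -/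
theorem schwartzBruhat_stable (ν : Model L →* Circle) :
    ∀ (k : Model L) (f : Lp ℂ 2 (μ L)), f ∈ schwartzBruhat L → rep L ν k f ∈ schwartzBruhat L := by
  intro k f hf
  have hle : (schwartzBruhat L).map (rep L ν k).toLinearEquiv.toLinearMap ≤ schwartzBruhat L := by
    rw [schwartzBruhat, Submodule.map_span]
    refine Submodule.span_le.mpr ?_
    rintro _ ⟨_, ⟨A, rfl⟩, rfl⟩
    show rep L ν k (indCO L A.1 A.2.1 A.2.2) ∈ schwartzBruhat L
    rw [rep_indCO]
    exact Submodule.smul_mem _ _ (indCO_mem_schwartzBruhat _ _ _)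
  exact hle (Submodule.mem_map.mpr ⟨f, hf, rfl⟩)

/-! ## §2  The model vectors are Schwartz–Bruhat -/

/-- the shifted box `e + ∏ 𝒪_v³` is compact. -/
theorem isCompact_boxE (e : Space L) : IsCompact (boxE e) := by
  rw [boxE, ← Set.image_add_left]
  exact (box L).isCompact.image (continuous_const.add continuous_id)

/-- `φ_e = 1_{e + ∏ 𝒪_v³}` is the indicator of a compact open set. -/
theorem phiE_eq_indCO (e : Space L) : phiE e = indCO L (boxE e) (isCompact_boxE e) (isOpen_boxE e) := rfl

/-- **the model vector `φ_e` is Schwartz–Bruhat.** -/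
theorem phiE_mem_schwartzBruhat (e : Space L) : phiE e ∈ schwartzBruhat L := by
  rw [phiE_eq_indCO]
  exact indCO_mem_schwartzBruhat _ _ _

/-- **the cyclic subspace of `φ_e` consists of Schwartz–Bruhat functions.** -/
theorem cyclicSpan_le_schwartzBruhat (ν : Model L →* Circle) (e : Space L) :
    Transfer.cyclicSpan (rep L ν) (phiE e) ≤ schwartzBruhat L :=
  Submodule.span_le.mpr (by
    rintro _ ⟨g, rfl⟩
    exact schwartzBruhat_stable ν g _ (phiE_mem_schwartzBruhat e))

end Schwartz

/-! ## §3  The S3 END along an embedding of the Schwartz–Bruhat space -/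

section schwartzEmbed

variable (L : Type) [Field L] [NumberField L] [IsCMField L]

-- (no `L⁺` notation inside `variable` binders: a `notation3` token there does not re-elaborate)
variable [DecidableEq (Place (maximalRealSubfield L))]
    [∀ v : HeightOneSpectrum (𝓞 (maximalRealSubfield L)), MeasurableSpace (v.adicCompletion (maximalRealSubfield L))]
    [∀ v : HeightOneSpectrum (𝓞 (maximalRealSubfield L)), BorelSpace (v.adicCompletion (maximalRealSubfield L))]
    (S₀ : Finset (Place (maximalRealSubfield L)))
    {Sp : Type} [NormedAddCommGroup Sp] [InnerProductSpace ℂ Sp]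
    {W : Type} [AddCommGroup W] [Module L W]
    {H Sbox : Type} [Group H] [AddCommGroup Sbox] [Module ℂ Sbox]
    {h : W →ₗ⋆[L] W →ₗ[L] L} (hW : IsLine L W) (hh : Anisotropic h)
    (D : DoublingDatum (Model L) H Sp Sbox) (GU : ThetaSide Sp Sbox)
    (j : isomBox h →* H) (hj : ∀ d : unitary L, j ⟨iotaSnd d, iotaSnd_mem h d⟩ = D.ι (1, unitaryToModel L d))
    (χ : Model L →* Circle) (hχΓ : ∀ d : unitary L, χ (unitaryToModel L d) = 1)
    (hχVΓ : ∀ d : unitary L, D.χV (unitaryToModel L d) = 1)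
    {hP : ∀ Ψ : Sbox, ∀ p ∈ (stabDelta L W).subgroupOf (isomBox h), ∀ x : H, D.fSW Ψ (j p * x) = D.fSW Ψ x}
    (P : GluePrintInputs D GU h j hP)
    (hloc : ∀ (i : Place (maximalRealSubfield L)) (v : Sp),
      Continuous fun g : locTorus (maximalRealSubfield L) L i => D.ω (RestrictedProduct.mulSingle (genLevel L) i g) v)
    {T' : Finset (Place (maximalRealSubfield L))} (hχT' : RestrictedProduct.boxSubgroup (genLevel L) T' ≤ χ.ker)
    (hlocχ : ∀ i ∈ T', Continuous fun g : locTorus (maximalRealSubfield L) L i =>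
      χ (RestrictedProduct.mulSingle (genLevel L) i g))
    {S : Finset (Place (maximalRealSubfield L))} (hT'S : T' ⊆ S)
    (hS : ∀ v : InfinitePlace (maximalRealSubfield L), Sum.inl v ∈ S)

include hW hh hj hχΓ hχVΓ P hloc hT'S hS

set_option synthInstance.maxHeartbeats 200000 in
-- (as in the END theorem: the `SMul Γ (Model L)` instance behind `IsFundamentalDomain` is slow to find)
/-- **S3 END, torus side by the genuine split Schrödinger model ALONG AN EMBEDDING OF ITS SCHWARTZ–BRUHAT SPACE.**
For a doubling datum `D` on ANY space `Sp` (+ theta side, print inputs, `hloc`, the `χ`-side level data — unchanged)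
and an isometric embedding `E : schwartzBruhat L →ₗᵢ[ℂ] Sp` of the Schwartz–Bruhat space of `X` equivariant for the
twisted dilation representation `rep L (twistChar L χ)` (restricted; it is stable by `schwartzBruhat_stable`): the
END's conclusion for the vector `E ⟨φ_e, _⟩`, `φ_e = phiE (shiftFor S χ hχT' hlocχ)`. -/
theorem exists_compactDomain_thetaLift_ne_zero_genuine_schwartzEmbed
    (E : schwartzBruhat L →ₗᵢ[ℂ] Sp)
    (hE : ∀ (g : Model L) (v : schwartzBruhat L),
      E (Transfer.restrict (rep L (twistChar L χ)) _ (schwartzBruhat_stable (twistChar L χ)) g v) = D.ω g (E v))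
    [IsFiniteMeasure GU.μ] :
    ∃ 𝓕 : Set (Model L), IsCompact 𝓕 ∧ (interior 𝓕).Nonempty ∧ MeasurableSet 𝓕 ∧
      IsFundamentalDomain (unitaryToModel L).range 𝓕
        (haarDatum (genLevel L) (isCompact_genLevel L) (isOpen_genLevel L) S₀).μ ∧
      (haarDatum (genLevel L) (isCompact_genLevel L) (isOpen_genLevel L) S₀).μ 𝓕 ≠ 0 ∧
      (haarDatum (genLevel L) (isCompact_genLevel L) (isOpen_genLevel L) S₀).μ 𝓕 ≠ ⊤ ∧
      ∀ [IsFiniteMeasure (((haarDatum (genLevel L) (isCompact_genLevel L) (isOpen_genLevel L) S₀).μ).restrict 𝓕)]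
        (hk : Measurable (Function.uncurry (thetaFn D GU
          (E ⟨phiE (shiftFor S χ hχT' hlocχ), phiE_mem_schwartzBruhat _⟩)))) {Ck : ℝ}
        (hCk : 0 ≤ Ck) (hkC : ∀ q u, ‖thetaFn D GU
          (E ⟨phiE (shiftFor S χ hχT' hlocχ), phiE_mem_schwartzBruhat _⟩) q u‖ ≤ Ck),
        PeterssonFubini.theta GU.μ
          (((haarDatum (genLevel L) (isCompact_genLevel L) (isOpen_genLevel L) S₀).μ).restrict 𝓕) hk
          (measurable_coe_char (genLevel L) (isOpen_genLevel L) χ hχT' hlocχ) hCk hkC (norm_coe_char_le χ) ≠ 0 :=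
  exists_compactDomain_thetaLift_ne_zero_genuine_subEmbed L S₀ hW hh D GU j hj χ hχΓ hχVΓ P hloc hχT' hlocχ hT'S hS
    _ (schwartzBruhat_stable (twistChar L χ)) (phiE_mem_schwartzBruhat _) E hE

end schwartzEmbed

end Coeff

end SchrodingerModel

end HodgeCM.PerL34.PureTensor

end
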